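import Summits.ResolutionOfSingularities.ResolutionOfSingularities.Theorems.PAlterationPalterationThesisPerfectAtoms
import Summits.ResolutionOfSingularities.ResolutionOfSingularities.Theorems.PAlterationPalterationThesisStubRRLU1OfPicoverOver
import Summits.ResolutionOfSingularities.ResolutionOfSingularities.Theorems.PAlterationPalterationThesisStubRRLU1OfZeroDim
import Summits.ResolutionOfSingularities.ResolutionOfSingularities.Theorems.PAlterationPalterationThesisStubTemkinAtOfZeroDim
import Summits.ResolutionOfSingularities.ResolutionOfSingularities.Theorems.PAlterationPialtBridgeFoliationDescent
import Literature.AlgebraicGeometry.Resolution.InseparableLocalUniformizationHeightStepTrustBase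
import Literature.AlgebraicGeometry.Resolution.DecompletionRoof
import Literature.AlgebraicGeometry.Resolution.LocalUniformizationAbhyankarPlaces
import HarnessLib

/-!
# `PalterationThesis` (crux stmt-ResolutionOfSingularities-0552), line `Sketch` rev. c4: the two
# valuation-theoretic atoms over a perfect field live at zero-dimensional non-Abhyankar valuations

Helper file of the line lead (c4) for the skeleton `Cruxes/PalterationThesis/Lines/Sketch.lean`
(`--supports stmt-ResolutionOfSingularities-0552`; it does not close the item). Rev. c3 displayed
the crux over a perfect field `K` of characteristic `p` as the three atoms `Temkin_K ∧ RRLU1_K ∧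
TMP_K` (`atoms_iff_resOver`, p138613). Two of them quantify over ALL valuation rings:
* `Temkin_K` — every valuation ring `O ∋ K` of a finitely generated `F/K` acquires, on a finite
  purely inseparable `L/F`, a valuation ring over it that is locally uniformizable over `K`;
* `RRLU1_K` — below a height-one Frobenius sandwich `K ⊆ F ⊆ L ⊇ B` (`B` regular, finitely
  generated, `Frac B = L`), every valuation ring `O ⊇ B` of `L` has `O ∩ F` locally
  uniformizable over `K`.
This file proves that both have content only at ZERO-DIMENSIONAL (residue field algebraic over
`K`) NON-ABHYANKAR valuation rings — their "cores" `TemkinCore_K`, `RRLU1Core_K` (inlined):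
* `isLocallyUniformizable_of_isAbhyankarPlace` — Knaf–Kuhlmann 2005 Thm. 1.1 (PROVED in the
  tree, `relLU_at_abhyankarPlace_of_perfectField`): an Abhyankar valuation ring of a function
  field over a perfect field is locally uniformizable outright;
* `temkinAt_of_core`, `rrLU1At_of_core` — core ⟹ atom (the Abhyankar case by Knaf–Kuhlmann, the
  positive-dimensional case by Zariski's closed-point reductions `stub_temkinAt_of_zeroDim`
  (p140251) and `stub_rrLU1_of_zeroDim` (p140114)); `coresAt_iff_atomsAt` — hence EQUIVALENT;
* `coresAt_and_tmp_iff_resOver`, `palterationThesis_iff_coresPerfect_and_descent` — the crux as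
  "the two cores and two-model patching over every perfect field, and `DescentPerfectToAll`";
* provenance by name: `temkinCore_of_temkin2013` (the Temkin core is a consequence of the named
  fact `Temkin2013`, Thm. 1.3.2 — a published theorem), `temkinCore_of_smoothFibre` (its one-leaf
  in-tree trust base), `rrLU1Core_of_picoverOver` (PICover over `K`, p138074),
  `rrLU1Core_of_folLU_logCanQuotLU` (route FoliationDescent, p137187).

Sources: H. Knaf, F.-V. Kuhlmann, Ann. Sci. ÉNS 38 (2005), Thm. 1.1 and Cor. 2.2; O. Zariski,
P. Samuel, *Commutative Algebra* II, Ch. VI §17; M. Temkin, J. Algebra 373 (2013), Thm. 1.3.2.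
-/

set_option linter.dupNamespace false -- mandated namespace of this single-conjunct summit

noncomputable section

open CategoryTheory AlgebraicGeometry TopologicalSpace IsLocalRing
open Literature.AlgebraicGeometry.Resolution
open Summit.ResolutionOfSingularities.ResolutionOfSingularities.Theses.PAlteration
open Summit.ResolutionOfSingularities.ResolutionOfSingularities.Theses.Descent (DescentPerfectToAll)
open Summit.ResolutionOfSingularities.ResolutionOfSingularities.Theses.FoliationDescent (FolLU LogCanQuotLU)
open Summit.ResolutionOfSingularities.ResolutionOfSingularities.Theorems.Pialt.RadiciallyRegular
  (rrLU1_perfect_of_folLU_of_logCanQuotLU)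
open Summit.ResolutionOfSingularities.ResolutionOfSingularities.Theorems.PalterationThesis.PerfectTransfer

namespace Summit.ResolutionOfSingularities.ResolutionOfSingularities.Theorems.PalterationThesis.PerfectAtoms

/-! ## Abhyankar valuations are free over a perfect ground field -/

/-- **An Abhyankar valuation ring of a function field over a perfect field is locally
uniformizable** (Knaf–Kuhlmann 2005, Thm. 1.1 with Cor. 2.2; tree
`relLU_at_abhyankarPlace_of_perfectField`, with the trivial prescribed algebra `⊥`).
[cite: KnafKuhlmann2005, Thm. 1.1 and Cor. 2.2] -/
theorem isLocallyUniformizable_of_isAbhyankarPlace (K : Type) [Field K] [PerfectField K]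
    (F : Type) [Field F] [Algebra K F] (hfg : (⊤ : IntermediateField K F).FG)
    (O : ValuationSubring F) (hO : ∀ c : K, algebraMap K F c ∈ O)
    (hA : IsAbhyankarPlace O (algebraMap K F).fieldRange ⊤) :
    IsLocallyUniformizable K F O := by
  obtain ⟨A, h, -, hAfg, hfr, hreg⟩ := relLU_at_abhyankarPlace_of_perfectField hfg O hO hA ⊥
    Subalgebra.fg_bot (fun x hx => by
      obtain ⟨c, rfl⟩ := Algebra.mem_bot.mp hx
      exact hO c)
  exact ⟨A, h, hAfg, hfr, hreg⟩

/-! ## Temkin's statement over `K`: core ⟺ atom -/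

/-- **`Temkin_K` from its zero-dimensional non-Abhyankar core** (`K` perfect): the Abhyankar case
is Knaf–Kuhlmann with `L = F`, the positive-dimensional case the closed-point reduction with
hulls `stub_temkinAt_of_zeroDim`. [cite: KnafKuhlmann2005, Thm. 1.1] -/
theorem temkinAt_of_core (K : Type) [Field K] [PerfectField K]
    (hcore : ∀ (F : Type) [Field F] [Algebra K F], (⊤ : IntermediateField K F).FG →
      ∀ O : ValuationSubring F, (∀ c : K, algebraMap K F c ∈ O) →
        (∀ x ∈ O, ∃ f : Polynomial K, f ≠ 0 ∧ Polynomial.aeval x f ∈ O.nonunits) →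
        ¬ IsAbhyankarPlace O (algebraMap K F).fieldRange ⊤ →
        ∃ (L : Type) (_ : Field L) (_ : Algebra F L) (_ : Algebra K L) (_ : IsScalarTower K F L),
          FiniteDimensional F L ∧ IsPurelyInseparable F L ∧
          ∃ O' : ValuationSubring L, O'.comap (algebraMap F L) = O ∧
            IsLocallyUniformizable K L O') :
    ∀ (F : Type) [Field F] [Algebra K F], (⊤ : IntermediateField K F).FG →
      ∀ O : ValuationSubring F, (∀ c : K, algebraMap K F c ∈ O) →
        ∃ (L : Type) (_ : Field L) (_ : Algebra F L) (_ : Algebra K L) (_ : IsScalarTower K F L),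
          FiniteDimensional F L ∧ IsPurelyInseparable F L ∧
          ∃ O' : ValuationSubring L, O'.comap (algebraMap F L) = O ∧
            IsLocallyUniformizable K L O' := by
  refine stub_temkinAt_of_zeroDim K fun F _ _ hfg O hO h0 => ?_
  by_cases hA : IsAbhyankarPlace O (algebraMap K F).fieldRange ⊤
  · refine ⟨F, inferInstance, Algebra.id F, inferInstance, IsScalarTower.right, inferInstance,
      inferInstance, O, ?_, isLocallyUniformizable_of_isAbhyankarPlace K F hfg O hO hA⟩
    ext x
    simp [ValuationSubring.mem_comap]
  · exact hcore F hfg O hO h0 hA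

/-- **The core of `Temkin_K` is (trivially) a special case of `Temkin_K`.** [folklore] -/
theorem temkinCore_of_temkinAt (K : Type) [Field K]
    (hT : ∀ (F : Type) [Field F] [Algebra K F], (⊤ : IntermediateField K F).FG →
      ∀ O : ValuationSubring F, (∀ c : K, algebraMap K F c ∈ O) →
        ∃ (L : Type) (_ : Field L) (_ : Algebra F L) (_ : Algebra K L) (_ : IsScalarTower K F L),
          FiniteDimensional F L ∧ IsPurelyInseparable F L ∧
          ∃ O' : ValuationSubring L, O'.comap (algebraMap F L) = O ∧
            IsLocallyUniformizable K L O') :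
    ∀ (F : Type) [Field F] [Algebra K F], (⊤ : IntermediateField K F).FG →
      ∀ O : ValuationSubring F, (∀ c : K, algebraMap K F c ∈ O) →
        (∀ x ∈ O, ∃ f : Polynomial K, f ≠ 0 ∧ Polynomial.aeval x f ∈ O.nonunits) →
        ¬ IsAbhyankarPlace O (algebraMap K F).fieldRange ⊤ →
        ∃ (L : Type) (_ : Field L) (_ : Algebra F L) (_ : Algebra K L) (_ : IsScalarTower K F L),
          FiniteDimensional F L ∧ IsPurelyInseparable F L ∧
          ∃ O' : ValuationSubring L, O'.comap (algebraMap F L) = O ∧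
            IsLocallyUniformizable K L O' :=
  fun F _ _ hfg O hO _ _ => hT F hfg O hO

/-- **The Temkin core is a consequence of the named fact `Temkin2013`** (Temkin 2013, Thm. 1.3.2,
weak absolute form), read at the ground field `K`: any discharge `Temkin2013_holds` proves it by
this term. [cite: Temkin2013, Thm. 1.3.2] -/
theorem temkinCore_of_temkin2013 (hT : Temkin2013.{0}) (K : Type) [Field K] :
    ∀ (F : Type) [Field F] [Algebra K F], (⊤ : IntermediateField K F).FG →
      ∀ O : ValuationSubring F, (∀ c : K, algebraMap K F c ∈ O) →
        (∀ x ∈ O, ∃ f : Polynomial K, f ≠ 0 ∧ Polynomial.aeval x f ∈ O.nonunits) →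
        ¬ IsAbhyankarPlace O (algebraMap K F).fieldRange ⊤ →
        ∃ (L : Type) (_ : Field L) (_ : Algebra F L) (_ : Algebra K L) (_ : IsScalarTower K F L),
          FiniteDimensional F L ∧ IsPurelyInseparable F L ∧
          ∃ O' : ValuationSubring L, O'.comap (algebraMap F L) = O ∧
            IsLocallyUniformizable K L O' :=
  temkinCore_of_temkinAt K fun F _ _ hfg O hO => hT K F hfg O hO

/-- **The Temkin core has a one-leaf trust base in the tree**: the single named fact
`Temkin2013RelativeCurveSmoothFibre` (Temkin 2013, Thm. 3.3.1 for smooth generic fibres,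
Berkovich-analytic) implies it, through `Temkin2013.of_smoothFibre_lemma332nft` and the proved
decompletion Lemma 3.3.2 (`Temkin2013_Lemma332_nft_holds`).
[cite: Temkin2013, Thm. 3.3.1 and Lemma 3.3.2] -/
theorem temkinCore_of_smoothFibre (hsf : Temkin2013RelativeCurveSmoothFibre.{0}) (K : Type)
    [Field K] :
    ∀ (F : Type) [Field F] [Algebra K F], (⊤ : IntermediateField K F).FG →
      ∀ O : ValuationSubring F, (∀ c : K, algebraMap K F c ∈ O) →
        (∀ x ∈ O, ∃ f : Polynomial K, f ≠ 0 ∧ Polynomial.aeval x f ∈ O.nonunits) →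
        ¬ IsAbhyankarPlace O (algebraMap K F).fieldRange ⊤ →
        ∃ (L : Type) (_ : Field L) (_ : Algebra F L) (_ : Algebra K L) (_ : IsScalarTower K F L),
          FiniteDimensional F L ∧ IsPurelyInseparable F L ∧
          ∃ O' : ValuationSubring L, O'.comap (algebraMap F L) = O ∧
            IsLocallyUniformizable K L O' :=
  temkinCore_of_temkin2013 (Temkin2013.of_smoothFibre_lemma332nft hsf Temkin2013_Lemma332_nft_holds) K

/-! ## RRLU1 over `K`: core ⟺ atom -/

/-- **`RRLU1_K` from its zero-dimensional non-Abhyankar core** (`K` perfect): the Abhyankar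
case (for the trace `O ∩ F`) is Knaf–Kuhlmann, the positive-dimensional case the closed-point
reduction `stub_rrLU1_of_zeroDim`. [cite: KnafKuhlmann2005, Thm. 1.1] -/
theorem rrLU1At_of_core (p : ℕ) (K : Type) [Field K] [PerfectField K]
    (hcore : ∀ (F L : Type) [Field F] [Field L] [Algebra K F] [Algebra F L] [Algebra K L]
      [IsScalarTower K F L], (⊤ : IntermediateField K F).FG → IsPurelyInseparable F L →
      (∃ y : L, y ^ p ∈ (algebraMap F L).range ∧ IntermediateField.adjoin F {y} = ⊤) →
      ∀ B : Subalgebra K L, B.FG → IsFractionRing B L → IsRegularRing B →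
      ∀ O : ValuationSubring L, B.toSubring ≤ O.toSubring →
        (∀ x ∈ O, ∃ f : Polynomial K, f ≠ 0 ∧ Polynomial.aeval x f ∈ O.nonunits) →
        (∀ x ∈ O.comap (algebraMap F L), ∃ f : Polynomial K, f ≠ 0 ∧
          Polynomial.aeval x f ∈ (O.comap (algebraMap F L)).nonunits) →
        ¬ IsAbhyankarPlace (O.comap (algebraMap F L)) (algebraMap K F).fieldRange ⊤ →
        IsLocallyUniformizable K F (O.comap (algebraMap F L))) :
    ∀ (F L : Type) [Field F] [Field L] [Algebra K F] [Algebra F L] [Algebra K L]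
      [IsScalarTower K F L], (⊤ : IntermediateField K F).FG → IsPurelyInseparable F L →
      (∃ y : L, y ^ p ∈ (algebraMap F L).range ∧ IntermediateField.adjoin F {y} = ⊤) →
      ∀ B : Subalgebra K L, B.FG → IsFractionRing B L → IsRegularRing B →
      ∀ O : ValuationSubring L, B.toSubring ≤ O.toSubring →
        IsLocallyUniformizable K F (O.comap (algebraMap F L)) := by
  refine stub_rrLU1_of_zeroDim p K
    fun F L _ _ _ _ _ _ hfg hpi hy B hBfg hBfr hBreg O hBO h0L h0F => ?_
  by_cases hA : IsAbhyankarPlace (O.comap (algebraMap F L)) (algebraMap K F).fieldRange ⊤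
  · have hKO : ∀ c : K, algebraMap K F c ∈ O.comap (algebraMap F L) := fun c => by
      rw [ValuationSubring.mem_comap, ← IsScalarTower.algebraMap_apply]
      exact hBO (B.algebraMap_mem c)
    exact isLocallyUniformizable_of_isAbhyankarPlace K F hfg _ hKO hA
  · exact hcore F L hfg hpi hy B hBfg hBfr hBreg O hBO h0L h0F hA

/-- **The core of `RRLU1_K` is (trivially) a special case of `RRLU1_K`.** [folklore] -/
theorem rrLU1Core_of_rrLU1At (p : ℕ) (K : Type) [Field K]
    (h1 : ∀ (F L : Type) [Field F] [Field L] [Algebra K F] [Algebra F L] [Algebra K L]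
      [IsScalarTower K F L], (⊤ : IntermediateField K F).FG → IsPurelyInseparable F L →
      (∃ y : L, y ^ p ∈ (algebraMap F L).range ∧ IntermediateField.adjoin F {y} = ⊤) →
      ∀ B : Subalgebra K L, B.FG → IsFractionRing B L → IsRegularRing B →
      ∀ O : ValuationSubring L, B.toSubring ≤ O.toSubring →
        IsLocallyUniformizable K F (O.comap (algebraMap F L))) :
    ∀ (F L : Type) [Field F] [Field L] [Algebra K F] [Algebra F L] [Algebra K L]
      [IsScalarTower K F L], (⊤ : IntermediateField K F).FG → IsPurelyInseparable F L →
      (∃ y : L, y ^ p ∈ (algebraMap F L).range ∧ IntermediateField.adjoin F {y} = ⊤) →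
      ∀ B : Subalgebra K L, B.FG → IsFractionRing B L → IsRegularRing B →
      ∀ O : ValuationSubring L, B.toSubring ≤ O.toSubring →
        (∀ x ∈ O, ∃ f : Polynomial K, f ≠ 0 ∧ Polynomial.aeval x f ∈ O.nonunits) →
        (∀ x ∈ O.comap (algebraMap F L), ∃ f : Polynomial K, f ≠ 0 ∧
          Polynomial.aeval x f ∈ (O.comap (algebraMap F L)).nonunits) →
        ¬ IsAbhyankarPlace (O.comap (algebraMap F L)) (algebraMap K F).fieldRange ⊤ →
        IsLocallyUniformizable K F (O.comap (algebraMap F L)) :=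
  fun F L _ _ _ _ _ _ hfg hpi hy B hBfg hBfr hBreg O hBO _ _ _ =>
    h1 F L hfg hpi hy B hBfg hBfr hBreg O hBO

/-- **The RRLU1 core from PICover over `K`** (the Picover conjunct of the crux read at the
perfect field `K`; `stub_rrLU1_of_picoverOver`, p138074: Frobenius sandwich and Frobenius
domination). [cite: Temkin2013, Rem. 1.3.5 (ii)–(iii)] -/
theorem rrLU1Core_of_picoverOver (p : ℕ) (hp : p.Prime) (K : Type) [Field K] [CharP K p]
    [PerfectField K]
    (hPC : ∀ (Y X : Scheme.{0}) (f : Y ⟶ Spec (.of K)) (g : X ⟶ Y),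
      IsSeparated f → LocallyOfFiniteType f → QuasiCompact f → IsIntegral Y →
      Scheme.IsRegular Y → IsIntegral X → IsFinite g → UniversallyInjective g →
      Function.Surjective g.base → Scheme.HasResolution X) :
    ∀ (F L : Type) [Field F] [Field L] [Algebra K F] [Algebra F L] [Algebra K L]
      [IsScalarTower K F L], (⊤ : IntermediateField K F).FG → IsPurelyInseparable F L →
      (∃ y : L, y ^ p ∈ (algebraMap F L).range ∧ IntermediateField.adjoin F {y} = ⊤) →
      ∀ B : Subalgebra K L, B.FG → IsFractionRing B L → IsRegularRing B →
      ∀ O : ValuationSubring L, B.toSubring ≤ O.toSubring →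
        (∀ x ∈ O, ∃ f : Polynomial K, f ≠ 0 ∧ Polynomial.aeval x f ∈ O.nonunits) →
        (∀ x ∈ O.comap (algebraMap F L), ∃ f : Polynomial K, f ≠ 0 ∧
          Polynomial.aeval x f ∈ (O.comap (algebraMap F L)).nonunits) →
        ¬ IsAbhyankarPlace (O.comap (algebraMap F L)) (algebraMap K F).fieldRange ⊤ →
        IsLocallyUniformizable K F (O.comap (algebraMap F L)) :=
  rrLU1Core_of_rrLU1At p K (stub_rrLU1_of_picoverOver p hp K hPC)

/-- **The RRLU1 core from route `FoliationDescent`** (`FolLU ∧ LogCanQuotLU`, item 0555's bridge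
`rrLU1_perfect_of_folLU_of_logCanQuotLU`, p137187). [folklore] -/
theorem rrLU1Core_of_folLU_logCanQuotLU (hF : FolLU) (hQ : LogCanQuotLU) (p : ℕ) (hp : p.Prime)
    (K : Type) [Field K] [CharP K p] [PerfectField K] :
    ∀ (F L : Type) [Field F] [Field L] [Algebra K F] [Algebra F L] [Algebra K L]
      [IsScalarTower K F L], (⊤ : IntermediateField K F).FG → IsPurelyInseparable F L →
      (∃ y : L, y ^ p ∈ (algebraMap F L).range ∧ IntermediateField.adjoin F {y} = ⊤) →
      ∀ B : Subalgebra K L, B.FG → IsFractionRing B L → IsRegularRing B →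
      ∀ O : ValuationSubring L, B.toSubring ≤ O.toSubring →
        (∀ x ∈ O, ∃ f : Polynomial K, f ≠ 0 ∧ Polynomial.aeval x f ∈ O.nonunits) →
        (∀ x ∈ O.comap (algebraMap F L), ∃ f : Polynomial K, f ≠ 0 ∧
          Polynomial.aeval x f ∈ (O.comap (algebraMap F L)).nonunits) →
        ¬ IsAbhyankarPlace (O.comap (algebraMap F L)) (algebraMap K F).fieldRange ⊤ →
        IsLocallyUniformizable K F (O.comap (algebraMap F L)) :=
  rrLU1Core_of_rrLU1At p K fun F L _ _ _ _ _ _ => rrLU1_perfect_of_folLU_of_logCanQuotLU hF hQ p hp K F L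

/-! ## The two cores over a perfect field are exactly the two atoms; the crux displayed -/

/-- **Over a perfect field `K`: (TemkinCore_K ∧ RRLU1Core_K) ⟺ (Temkin_K ∧ RRLU1_K)** — the two
valuation-theoretic atoms of rev. c3 have content only at zero-dimensional non-Abhyankar
valuation rings. [cite: KnafKuhlmann2005, Thm. 1.1; ZariskiSamuel1960, Ch. VI §17] -/
theorem coresAt_iff_atomsAt (p : ℕ) (K : Type) [Field K] [PerfectField K] :
    ((∀ (F : Type) [Field F] [Algebra K F], (⊤ : IntermediateField K F).FG →
        ∀ O : ValuationSubring F, (∀ c : K, algebraMap K F c ∈ O) →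
          (∀ x ∈ O, ∃ f : Polynomial K, f ≠ 0 ∧ Polynomial.aeval x f ∈ O.nonunits) →
          ¬ IsAbhyankarPlace O (algebraMap K F).fieldRange ⊤ →
          ∃ (L : Type) (_ : Field L) (_ : Algebra F L) (_ : Algebra K L)
            (_ : IsScalarTower K F L),
            FiniteDimensional F L ∧ IsPurelyInseparable F L ∧
            ∃ O' : ValuationSubring L, O'.comap (algebraMap F L) = O ∧
              IsLocallyUniformizable K L O') ∧
      (∀ (F L : Type) [Field F] [Field L] [Algebra K F] [Algebra F L] [Algebra K L]
        [IsScalarTower K F L], (⊤ : IntermediateField K F).FG → IsPurelyInseparable F L →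
        (∃ y : L, y ^ p ∈ (algebraMap F L).range ∧ IntermediateField.adjoin F {y} = ⊤) →
        ∀ B : Subalgebra K L, B.FG → IsFractionRing B L → IsRegularRing B →
        ∀ O : ValuationSubring L, B.toSubring ≤ O.toSubring →
          (∀ x ∈ O, ∃ f : Polynomial K, f ≠ 0 ∧ Polynomial.aeval x f ∈ O.nonunits) →
          (∀ x ∈ O.comap (algebraMap F L), ∃ f : Polynomial K, f ≠ 0 ∧
            Polynomial.aeval x f ∈ (O.comap (algebraMap F L)).nonunits) →
          ¬ IsAbhyankarPlace (O.comap (algebraMap F L)) (algebraMap K F).fieldRange ⊤ →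
          IsLocallyUniformizable K F (O.comap (algebraMap F L)))) ↔
    ((∀ (F : Type) [Field F] [Algebra K F], (⊤ : IntermediateField K F).FG →
        ∀ O : ValuationSubring F, (∀ c : K, algebraMap K F c ∈ O) →
          ∃ (L : Type) (_ : Field L) (_ : Algebra F L) (_ : Algebra K L)
            (_ : IsScalarTower K F L),
            FiniteDimensional F L ∧ IsPurelyInseparable F L ∧
            ∃ O' : ValuationSubring L, O'.comap (algebraMap F L) = O ∧
              IsLocallyUniformizable K L O') ∧
      (∀ (F L : Type) [Field F] [Field L] [Algebra K F] [Algebra F L] [Algebra K L]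
        [IsScalarTower K F L], (⊤ : IntermediateField K F).FG → IsPurelyInseparable F L →
        (∃ y : L, y ^ p ∈ (algebraMap F L).range ∧ IntermediateField.adjoin F {y} = ⊤) →
        ∀ B : Subalgebra K L, B.FG → IsFractionRing B L → IsRegularRing B →
        ∀ O : ValuationSubring L, B.toSubring ≤ O.toSubring →
          IsLocallyUniformizable K F (O.comap (algebraMap F L)))) :=
  ⟨fun h => ⟨temkinAt_of_core K h.1, rrLU1At_of_core p K h.2⟩,
    fun h => ⟨temkinCore_of_temkinAt K h.1, rrLU1Core_of_rrLU1At p K h.2⟩⟩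

/-- **Over a perfect field `K` of characteristic `p`: (TemkinCore_K ∧ RRLU1Core_K ∧ TMP_K) ⟺
resolution of every reduced separated `K`-scheme of finite type** (`coresAt_iff_atomsAt` and
rev. c3's `atoms_iff_resOver`). [cite: Piltant2013, Prop. 5.1 and Cor. 5.7] -/
theorem coresAt_and_tmp_iff_resOver (p : ℕ) (hp : p.Prime) (K : Type) [Field K] [CharP K p]
    [PerfectField K] :
    ((∀ (F : Type) [Field F] [Algebra K F], (⊤ : IntermediateField K F).FG →
        ∀ O : ValuationSubring F, (∀ c : K, algebraMap K F c ∈ O) →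
          (∀ x ∈ O, ∃ f : Polynomial K, f ≠ 0 ∧ Polynomial.aeval x f ∈ O.nonunits) →
          ¬ IsAbhyankarPlace O (algebraMap K F).fieldRange ⊤ →
          ∃ (L : Type) (_ : Field L) (_ : Algebra F L) (_ : Algebra K L)
            (_ : IsScalarTower K F L),
            FiniteDimensional F L ∧ IsPurelyInseparable F L ∧
            ∃ O' : ValuationSubring L, O'.comap (algebraMap F L) = O ∧
              IsLocallyUniformizable K L O') ∧
      (∀ (F L : Type) [Field F] [Field L] [Algebra K F] [Algebra F L] [Algebra K L]
        [IsScalarTower K F L], (⊤ : IntermediateField K F).FG → IsPurelyInseparable F L →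
        (∃ y : L, y ^ p ∈ (algebraMap F L).range ∧ IntermediateField.adjoin F {y} = ⊤) →
        ∀ B : Subalgebra K L, B.FG → IsFractionRing B L → IsRegularRing B →
        ∀ O : ValuationSubring L, B.toSubring ≤ O.toSubring →
          (∀ x ∈ O, ∃ f : Polynomial K, f ≠ 0 ∧ Polynomial.aeval x f ∈ O.nonunits) →
          (∀ x ∈ O.comap (algebraMap F L), ∃ f : Polynomial K, f ≠ 0 ∧
            Polynomial.aeval x f ∈ (O.comap (algebraMap F L)).nonunits) →
          ¬ IsAbhyankarPlace (O.comap (algebraMap F L)) (algebraMap K F).fieldRange ⊤ →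
          IsLocallyUniformizable K F (O.comap (algebraMap F L))) ∧
      (∀ (F : Type) [Field F] [Algebra K F] [Algebra.EssFiniteType K F],
        ∀ M₁ M₂ : ProperModel K F,
          ∃ (N : ProperModel K F) (φ₁ : N.Hom M₁) (φ₂ : N.Hom M₂), φ₁.RegLe ∧ φ₂.RegLe)) ↔
    ∀ (X : Scheme.{0}) (f : X ⟶ Spec (.of K)),
      IsSeparated f → LocallyOfFiniteType f → QuasiCompact f → IsReduced X →
      Scheme.HasResolution X := by
  rw [← atoms_iff_resOver p hp K, ← and_assoc, ← and_assoc, coresAt_iff_atomsAt p K]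

/-- **The crux `PalterationThesis` ⟺ the two cores and two-model patching over every PERFECT
field of every prime characteristic, and `DescentPerfectToAll`** — the display of skeleton
`Sketch` rev. c4 with its open residues (`palterationThesis_iff_atomsPerfect_and_descent`,
`coresAt_iff_atomsAt`). [folklore] -/
theorem palterationThesis_iff_coresPerfect_and_descent :
    PalterationThesis ↔
      (∀ p : ℕ, p.Prime → ∀ (K : Type) [Field K] [CharP K p] [PerfectField K],
        (∀ (F : Type) [Field F] [Algebra K F], (⊤ : IntermediateField K F).FG →
          ∀ O : ValuationSubring F, (∀ c : K, algebraMap K F c ∈ O) →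
            (∀ x ∈ O, ∃ f : Polynomial K, f ≠ 0 ∧ Polynomial.aeval x f ∈ O.nonunits) →
            ¬ IsAbhyankarPlace O (algebraMap K F).fieldRange ⊤ →
            ∃ (L : Type) (_ : Field L) (_ : Algebra F L) (_ : Algebra K L)
              (_ : IsScalarTower K F L),
              FiniteDimensional F L ∧ IsPurelyInseparable F L ∧
              ∃ O' : ValuationSubring L, O'.comap (algebraMap F L) = O ∧
                IsLocallyUniformizable K L O') ∧
        (∀ (F L : Type) [Field F] [Field L] [Algebra K F] [Algebra F L] [Algebra K L]
          [IsScalarTower K F L], (⊤ : IntermediateField K F).FG → IsPurelyInseparable F L →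
          (∃ y : L, y ^ p ∈ (algebraMap F L).range ∧ IntermediateField.adjoin F {y} = ⊤) →
          ∀ B : Subalgebra K L, B.FG → IsFractionRing B L → IsRegularRing B →
          ∀ O : ValuationSubring L, B.toSubring ≤ O.toSubring →
            (∀ x ∈ O, ∃ f : Polynomial K, f ≠ 0 ∧ Polynomial.aeval x f ∈ O.nonunits) →
            (∀ x ∈ O.comap (algebraMap F L), ∃ f : Polynomial K, f ≠ 0 ∧
              Polynomial.aeval x f ∈ (O.comap (algebraMap F L)).nonunits) →
            ¬ IsAbhyankarPlace (O.comap (algebraMap F L)) (algebraMap K F).fieldRange ⊤ →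
            IsLocallyUniformizable K F (O.comap (algebraMap F L))) ∧
        (∀ (F : Type) [Field F] [Algebra K F] [Algebra.EssFiniteType K F],
          ∀ M₁ M₂ : ProperModel K F,
            ∃ (N : ProperModel K F) (φ₁ : N.Hom M₁) (φ₂ : N.Hom M₂), φ₁.RegLe ∧ φ₂.RegLe)) ∧
      DescentPerfectToAll := by
  rw [palterationThesis_iff_atomsPerfect_and_descent]
  refine and_congr_left fun _ => ?_
  refine forall_congr' fun p => forall_congr' fun _ => forall_congr' fun K => ?_
  refine forall_congr' fun _ => forall_congr' fun _ => forall_congr' fun _ => ?_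
  rw [← and_assoc, ← and_assoc, coresAt_iff_atomsAt p K]

end Summit.ResolutionOfSingularities.ResolutionOfSingularities.Theorems.PalterationThesis.PerfectAtoms

end
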